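import Summits.Ventures.PercRepro.Night2LocalD2OnePairDefs

/-!
# PercRepro — the (6,4) cell `|E ∖ G| = 2` when all 2-cocircuit members share one hyperplane (night-2, gen 14)

Columns and the theorem for the pair-5 rule `opW` of Night2LocalD2OnePairDefs.  **`localShadowHall_d2_of_one_pair`**:
`G ∈ flatsQ M 5`, `|E ∖ G| = 2`, every member `B` below `G` has `|G ∖ cl B| ≥ 2` (no coloop of `M|G` carries
members), and any two members with `|G ∖ cl B| = 2` have the same closure (at most one 2-cocircuit of `M|G` carries
members) ⟹ `LocalShadowHall M 4 G`.

Columns at a shadow set `S` with `κ₀` coloops: `≤ κ₀/5` from the covering preimages (`opCov_le`); the pair and far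
preimages `B` have `S ∖ B` a series pair of `S` (`card_pairPre_le`), the far preimages are pair preimages
(`opFarPre_subset_pairPre`) and number at most one (`card_opFarPre_le_one`: two far preimages `B, B'` have
`S ∖ B = G ∖ cl B = G ∖ cl B' = S ∖ B'`), so with `P := #seriesPairs S`, `2P ≤ (6−κ₀)(5−κ₀)`, the column is
`≤ κ₀/5 + P/25 + (4/25)·[far]`, and a far preimage forces `P ≥ 1`, hence `κ₀ ≤ 4`: at most `1` in every case
(`op_col_arith`: `5κ₀ + P + 4[far] ≤ 25`).
-/

namespace PercRepro.Shadow

open Finset PerFlat ThmH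

variable {α : Type*} [DecidableEq α] {M : Matroid α} [M.Finite]

/-! ## Columns -/

open scoped Classical in
/-- The far preimages of `S`: the `m = 2` members whose far set is `S`. -/
noncomputable def opFarPre (M : Matroid α) [M.Finite] (G S : Finset α) : Finset (Finset α) :=
  (membersIn M (Uq M (4 + 2) 4) G).filter (fun B => (G \ clF M B).card = 2 ∧ S = B ∪ (G \ clF M B))

open scoped Classical in
/-- The far part of a column is `(1/5)·#opFarPre S`. -/
theorem sum_opFar_col (G S : Finset α) :
    ∑ B ∈ membersIn M (Uq M (4 + 2) 4) G, (if B ∈ membersIn M (Uq M (4 + 2) 4) G then opFar M G B S else 0) =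
      ((opFarPre M G S).card : ℚ) * (1 / 5) := by
  unfold opFarPre
  rw [Finset.card_eq_sum_ones, Nat.cast_sum, Finset.sum_mul, Finset.sum_filter]
  apply Finset.sum_congr rfl
  intro B hB
  simp only [hB, if_true, Nat.cast_one, one_mul]
  unfold opFar
  split_ifs <;> rfl

open scoped Classical in
/-- Far preimages are pair preimages. -/
theorem opFarPre_subset_pairPre (G S : Finset α) : opFarPre M G S ⊆ pairPre M 4 G S := by
  intro B hB
  unfold opFarPre at hB
  unfold pairPre
  rw [Finset.mem_filter] at hB ⊢
  refine ⟨hB.1, G \ clF M B, ?_, hB.2.2⟩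
  rw [Finset.mem_powersetCard]
  exact ⟨le_refl _, hB.2.1⟩

open scoped Classical in
/-- Under the one-hyperplane hypothesis, `S` has at most one far preimage. -/
theorem card_opFarPre_le_one {G : Finset α}
    (hone : ∀ B ∈ membersIn M (Uq M (4 + 2) 4) G, ∀ B' ∈ membersIn M (Uq M (4 + 2) 4) G,
      (G \ clF M B).card = 2 → (G \ clF M B').card = 2 → clF M B = clF M B')
    (S : Finset α) : (opFarPre M G S).card ≤ 1 := by
  rw [Finset.card_le_one]
  intro B hB B' hB'
  unfold opFarPre at hB hB'
  rw [Finset.mem_filter] at hB hB'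
  obtain ⟨hBm, hB2, hBS⟩ := hB
  obtain ⟨hB'm, hB'2, hB'S⟩ := hB'
  have hcl := hone B hBm B' hB'm hB2 hB'2
  have hBU : B ∈ Uq M (4 + 2) 4 := (mem_membersIn.1 hBm).1
  have hB'U : B' ∈ Uq M (4 + 2) 4 := (mem_membersIn.1 hB'm).1
  -- `B = S ∖ (G ∖ cl B)` and the same for `B'`, with the same complement
  have key : ∀ C, C ∈ Uq M (4 + 2) 4 → S = C ∪ (G \ clF M C) → C = S \ (G \ clF M C) := by
    intro C hC hSC
    rw [hSC, Finset.union_sdiff_right]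
    symm
    rw [Finset.sdiff_eq_self_iff_disjoint, Finset.disjoint_left]
    intro e heC he
    exact (Finset.mem_sdiff.1 he).2 (subset_clF hC heC)
  rw [key B hBU hBS, key B' hB'U hB'S, hcl]

/-- The arithmetic of the column: `a/5 + P/25 + (4/25)·f ≤ 1` for `2P ≤ (6−a)(5−a)`, `a ≤ 5`, `f ≤ 1` and
`f = 1 → 1 ≤ P`. -/
theorem op_col_arith {a P f : ℕ} (ha : a ≤ 5) (hP : 2 * P ≤ (4 + 2 - a) * (4 + 1 - a)) (hf : f ≤ 1)
    (hfP : f = 1 → 1 ≤ P) :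
    (a : ℚ) * (1 / 5) + (P : ℚ) * (1 / 25) + (f : ℚ) * (4 / 25) ≤ 1 := by
  have hnat : 5 * a + P + 4 * f ≤ 25 := by
    interval_cases f <;> interval_cases a <;> omega
  have hq : ((5 * a + P + 4 * f : ℕ) : ℚ) ≤ 25 := by exact_mod_cast hnat
  push_cast at hq
  linarith


open scoped Classical in
/-- The covering part of a column is the sum over the covering preimages. -/
theorem sum_opW_cov_col (G S : Finset α) :
    ∑ B ∈ membersIn M (Uq M (4 + 2) 4) G,
        (if B ∈ membersIn M (Uq M (4 + 2) 4) G ∧ S ∈ coverSets M B G then opCov M G B else 0) =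
      ∑ B ∈ coverPreimages M (Uq M (4 + 2) 4) G S, opCov M G B := by
  unfold coverPreimages
  rw [Finset.sum_filter]
  apply Finset.sum_congr rfl
  intro B hB
  simp only [hB, true_and]

open scoped Classical in
/-- Far preimages are the pair preimages with `|G ∖ cl B| = 2`. -/
theorem opFarPre_subset_filter (G S : Finset α) :
    opFarPre M G S ⊆ (pairPre M 4 G S).filter (fun B => (G \ clF M B).card = 2) := by
  intro B hB
  rw [Finset.mem_filter]
  refine ⟨opFarPre_subset_pairPre G S hB, ?_⟩
  unfold opFarPre at hB
  rw [Finset.mem_filter] at hB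
  exact hB.2.1

open scoped Classical in
/-- The pair part of a column is at most `(#pairPre S − #opFarPre S)/25`. -/
theorem sum_opW_pair_col_le {G : Finset α}
    (hc : ∀ B ∈ membersIn M (Uq M (4 + 2) 4) G, (gr M \ clF M B).card = (G \ clF M B).card + 2)
    (S : Finset α) :
    ∑ B ∈ membersIn M (Uq M (4 + 2) 4) G, (if B ∈ membersIn M (Uq M (4 + 2) 4) G then
        ∑ P ∈ Finset.powersetCard 2 (G \ clF M B), (if S = B ∪ P then cpPair M 4 G B else 0) else 0) ≤
      (((pairPre M 4 G S).card : ℚ) - ((opFarPre M G S).card : ℚ)) * (1 / 25) := by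
  have hsub := opFarPre_subset_filter (M := M) G S
  have hcard : (opFarPre M G S).card + ((pairPre M 4 G S).filter (fun B => ¬ (G \ clF M B).card = 2)).card ≤
      (pairPre M 4 G S).card := by
    rw [← Finset.card_filter_add_card_filter_not (s := pairPre M 4 G S)
      (p := fun B => (G \ clF M B).card = 2)]
    exact Nat.add_le_add_right (Finset.card_le_card hsub) _
  calc ∑ B ∈ membersIn M (Uq M (4 + 2) 4) G, (if B ∈ membersIn M (Uq M (4 + 2) 4) G then
        ∑ P ∈ Finset.powersetCard 2 (G \ clF M B), (if S = B ∪ P then cpPair M 4 G B else 0) else 0)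
      ≤ ∑ B ∈ membersIn M (Uq M (4 + 2) 4) G,
          (if (∃ P ∈ Finset.powersetCard 2 (G \ clF M B), S = B ∪ P) then
            (if (G \ clF M B).card = 2 then 0 else 1 / 25) else 0) := by
        apply Finset.sum_le_sum
        intro B hB
        simp only [hB, if_true]
        refine (sum_pair_ite_le hB S).trans ?_
        split_ifs with h1 h2
        · -- `m = 2`: `cpPair = 0`
          unfold cpPair
          have : ¬ ((gr M \ clF M B).card = 4 + 1) := by rw [hc B hB]; omega
          simp only [this, if_false, le_refl]
        · exact cpPair_four_le (hc B hB)
        · exact le_refl _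
    _ = ∑ B ∈ pairPre M 4 G S, (if (G \ clF M B).card = 2 then 0 else 1 / 25) := by
        unfold pairPre
        rw [Finset.sum_filter]
    _ = (((pairPre M 4 G S).filter (fun B => ¬ (G \ clF M B).card = 2)).card : ℚ) * (1 / 25) := by
        rw [Finset.sum_ite, Finset.sum_const_zero, zero_add, Finset.sum_const, nsmul_eq_mul]
    _ ≤ (((pairPre M 4 G S).card : ℚ) - ((opFarPre M G S).card : ℚ)) * (1 / 25) := by
        apply mul_le_mul_of_nonneg_right _ (by norm_num)
        have h := hcard
        have h' : (((opFarPre M G S).card : ℚ)) +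
            (((pairPre M 4 G S).filter (fun B => ¬ (G \ clF M B).card = 2)).card : ℚ) ≤
            ((pairPre M 4 G S).card : ℚ) := by exact_mod_cast h
        linarith

open scoped Classical in
/-- **The column bound** of the pair-5 rule under the one-hyperplane hypothesis. -/
theorem sum_opW_col_le {G : Finset α} (hG : G ∈ flatsQ M (4 + 1)) (hd : (gr M \ G).card = 2)
    (hone : ∀ B ∈ membersIn M (Uq M (4 + 2) 4) G, ∀ B' ∈ membersIn M (Uq M (4 + 2) 4) G,
      (G \ clF M B).card = 2 → (G \ clF M B').card = 2 → clF M B = clF M B')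
    {S : Finset α} (hS : S ∈ shadowAt M (4 + 2) 4 (Uq M (4 + 2) 4) G) :
    ∑ B ∈ membersIn M (Uq M (4 + 2) 4) G, opW M G B S ≤ 1 := by
  have hGg : G ⊆ gr M := (mem_flatsQ.1 hG).1
  have hc : ∀ B ∈ membersIn M (Uq M (4 + 2) 4) G, (gr M \ clF M B).card = (G \ clF M B).card + 2 := by
    intro B hB
    rw [card_sdiff_clF_eq_add hGg (mem_membersIn.1 hB).2, hd]
  have hSG : S ⊆ G := subset_of_mem_shadowAt hS
  have hSE : S ⊆ gr M := hSG.trans hGg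
  have hSY : S ∈ Yq M (4 + 2) 4 := shadow_subset_Yq _ (mem_shadowAt.1 hS).1
  have hSr : rkN M S = 4 + 1 := by
    unfold rkN; rw [eRk_eq_of_mem_Yq_diag hSY]; rfl
  have hcol : (coloops M S).card ≤ 4 + 1 := card_coloops_le hSE (eRk_eq_of_mem_Yq_diag hSY)
  have hP := two_mul_card_seriesPairs_le hSE hSr
  have hpp := card_pairPre_le hG hS
  have hfar := card_opFarPre_le_one hone S
  have hfp : (opFarPre M G S).card ≤ (pairPre M 4 G S).card := Finset.card_le_card (opFarPre_subset_pairPre G S)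
  unfold opW
  rw [Finset.sum_add_distrib, Finset.sum_add_distrib, sum_opW_cov_col, sum_opFar_col]
  have hcov : ∑ B ∈ coverPreimages M (Uq M (4 + 2) 4) G S, opCov M G B ≤
      ((coloops M S).card : ℚ) * (1 / 5) := by
    calc ∑ B ∈ coverPreimages M (Uq M (4 + 2) 4) G S, opCov M G B
        ≤ ∑ B ∈ coverPreimages M (Uq M (4 + 2) 4) G S, (1 / 5 : ℚ) := by
          apply Finset.sum_le_sum
          intro B hB
          exact opCov_le (hc B (mem_coverPreimages.1 hB).1)
      _ = ((coverPreimages M (Uq M (4 + 2) 4) G S).card : ℚ) * (1 / 5) := by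
          rw [Finset.sum_const, nsmul_eq_mul]
      _ ≤ ((coloops M S).card : ℚ) * (1 / 5) := by
          apply mul_le_mul_of_nonneg_right _ (by norm_num)
          exact_mod_cast card_coverPreimages_le_card_coloops (le_refl _) G S
  have hpair := sum_opW_pair_col_le hc S
  have harith := op_col_arith (a := (coloops M S).card) (P := (pairPre M 4 G S).card)
    (f := (opFarPre M G S).card) hcol (by omega) hfar (by intro h; omega)
  calc _ ≤ ((coloops M S).card : ℚ) * (1 / 5) +
      (((pairPre M 4 G S).card : ℚ) - ((opFarPre M G S).card : ℚ)) * (1 / 25) +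
      ((opFarPre M G S).card : ℚ) * (1 / 5) := add_le_add (add_le_add hcov hpair) (le_refl _)
    _ = ((coloops M S).card : ℚ) * (1 / 5) + ((pairPre M 4 G S).card : ℚ) * (1 / 25) +
      ((opFarPre M G S).card : ℚ) * (4 / 25) := by ring
    _ ≤ 1 := harith

/-! ## The theorem -/

open scoped Classical in
/-- **The (6,4) cell `|E ∖ G| = 2` with one 2-cocircuit hyperplane.**  `G ∈ flatsQ M 5`, `|E ∖ G| = 2`, every
member below `G` has `|G ∖ cl B| ≥ 2`, and any two members with `|G ∖ cl B| = 2` share their closure ⟹ (LI_G). -/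
theorem localShadowHall_d2_of_one_pair {G : Finset α} (hG : G ∈ flatsQ M (4 + 1))
    (hd : (gr M \ G).card = 2)
    (hm2 : ∀ B ∈ membersIn M (Uq M (4 + 2) 4) G, 2 ≤ (G \ clF M B).card)
    (hone : ∀ B ∈ membersIn M (Uq M (4 + 2) 4) G, ∀ B' ∈ membersIn M (Uq M (4 + 2) 4) G,
      (G \ clF M B).card = 2 → (G \ clF M B').card = 2 → clF M B = clF M B') :
    LocalShadowHall M 4 G := by
  have hGg : G ⊆ gr M := (mem_flatsQ.1 hG).1
  have hc : ∀ B ∈ membersIn M (Uq M (4 + 2) 4) G, (gr M \ clF M B).card = (G \ clF M B).card + 2 := by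
    intro B hB
    rw [card_sdiff_clF_eq_add hGg (mem_membersIn.1 hB).2, hd]
  apply localShadowHall_of_full_matching (opW M G)
  · intro B S
    exact opW_nonneg G B S
  · intro B S h
    unfold opW at h
    by_cases h1 : (if B ∈ membersIn M (Uq M (4 + 2) 4) G ∧ S ∈ coverSets M B G then opCov M G B else 0) = 0
    · by_cases h2 : (if B ∈ membersIn M (Uq M (4 + 2) 4) G then
          ∑ P ∈ Finset.powersetCard 2 (G \ clF M B), (if S = B ∪ P then cpPair M 4 G B else 0) else 0) = 0
      · rw [h1, h2, zero_add, zero_add] at h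
        split_ifs at h with hB
        · unfold opFar at h
          split_ifs at h with hf
          · rw [hf.2]; exact Finset.subset_union_left
          · exact absurd rfl h
        · exact absurd rfl h
      · split_ifs at h2 with hB
        · obtain ⟨P, hP, hne⟩ := Finset.exists_ne_zero_of_sum_ne_zero h2
          split_ifs at hne with hSP
          · rw [hSP]; exact Finset.subset_union_left
          · exact absurd rfl hne
        · exact absurd rfl h2
    · split_ifs at h1 with hcv
      · obtain ⟨z, -, rfl⟩ := mem_coverSets.1 hcv.2
        exact Finset.subset_insert _ _
      · exact absurd rfl h1
  · intro S hS
    exact sum_opW_col_le hG hd hone hS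
  · intro B hB
    exact row_opW_ge hG hB (hc B hB) (hm2 B hB)

end PercRepro.Shadow
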